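import Literature.AlgebraicGeometry.ShimuraVarieties.UnitaryCurveAuxiliaryPeriodEigenrows
import Literature.AlgebraicGeometry.ModuliOfAbelianVarieties.SiegelSpaceLeftEigenrows
import Literature.AlgebraicGeometry.ModuliOfAbelianVarieties.SiegelShimuraSet
import Literature.NumberTheory.ComplexMultiplication.CMTypeLattice
import Mathlib.Analysis.Matrix.Normed
import Mathlib.Topology.Separation.Hausdorff
import HarnessLib

/-!
# The period map of `J_Φ(v)`: `v ↦ Z(γ J_Φ(v) γ⁻¹) ∈ 𝔥_g` is holomorphic on the negative cone of `H^τ` (any rank `n`, frame-free)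
# (Deligne 1971, 1.14–1.15: a morphism of Shimura data induces a holomorphic map of hermitian symmetric domains; Deligne 1979 Prop. 2.3.10)

Topic `AlgebraicGeometry/ShimuraVarieties`; namespace `Literature.AlgebraicGeometry.ShimuraVarieties.UnitaryCurve.AuxV`.
Definitions with bodies (`rowEquivV`, `censusMatrixV`, `frameQVC`, `framePVC`, `periodRowsV`, `periodZV`, `censusSlopeMatrixV`, `periodRowsSlopeV`,
`periodChartMatrixV`) and theorems; no named fact, no instance, no notation, nothing asserted (net debt 0).
Cell `hodgecm-mathlib` (D-0151), FLOOR 0, P6 «MOD programme», door (E) of `stub_RGD`, organ **E2 FILE C** (LEAD F0P6-plan (g2) 2026-09-01T21:40:57Z;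
GEN heir A-p18 (g31) field type (F1) `Z ∕ Z_hol ∕ Z_mem`; E3 = A-p01 (g25) hypothesis `hZ` of `UnitaryCurveSiegelPointMap`; census
`F0/P6/A-p17/g27/CENSUS-E2-UnitaryCurveAuxiliaryPeriodMap.v1.A-p17g27.md` §0.4∕§0.6): the rank-`n`, `W₀`-free, frame-free twin of ★ rank-3 `UnitaryAuxiliaryPeriodMap`
§§1–4 + §6 (namespace `…UnitaryCanonicalModel.Aux`; the injective-differential §5 is not transcribed — E3's point separation is a slice argument).
`--supports stmt-HodgeConjecture-24832`, count-neutral; HC_CM is proved only modulo the printed citations until rung 0 closes.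

ROUTE («left eigenrows», as ★): THE PERIOD MATRIX IS DEFINED INTRINSICALLY, `periodZV F τ Φ γ v := siegelOfJ δ (γ J_Φ(v) γ⁻¹)` (★ `siegelOfJ`), so that
`Z ∈ 𝔥_g` and `γ J_Φ(v) γ⁻¹ = J(Z)` are ★ `siegelOfJ_mem` ∕ ★ `jOfSiegel_siegelOfJ` as soon as `γ J_Φ(v) γ⁻¹ ∈ C0 δ`.  HOLOMORPHY is local: on the CHART
`{v_k ≠ 0}` of the (open) negative cone, the census ★ FILE B of `g = n·#Φ` linearly independent left `+i`-eigenrows of `res(B_v)_ℂ`, AFFINE in `v`,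
gives `R_k(v) = S_k(v)·Q_ℂ·γ⁻¹` with `R_k(v)·(γ J_Φ(v) γ⁻¹)_ℂ = i·R_k(v)`, hence ★ `siegelOfJ_eq_of_leftEigenrows`: `Z(v) = Δ·R_k(v)₂⁻¹·R_k(v)₁` — a RATIONAL
function of `v`, differentiable where `det R_k(v)₂ ≠ 0`, i.e. on the whole chart; the charts `k : Fin n` cover the cone (`v ≠ 0` there).

* §1 `n·#Φ = g` (`card_index_eq`), `rowEquivV`; §2 `censusMatrixV k v`, `periodRowsV k γ v`, `auxComplexStructureV_map_ofReal` (`J_ℂ = P_ℂ·res(B_v)_ℂ·Q_ℂ`),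
  `periodRowsV_mul_conjJ` (`R·(γJγ⁻¹)_ℂ = i·R`), `periodRowsV_vecMul_injective` (chart `v_k ≠ 0`);
* §3 **`periodZV`**, `periodZV_mem` (`∈ 𝔥_g`), `conjJ_eq_jOfSiegel_periodZV`, `periodZV_eq_chart` (`= Δ·R₂⁻¹·R₁` on the chart), `periodZV_smul` (`Z(c v) = Z(v)`);
* §4 holomorphy: `censusMatrixV_eq_affine`, `periodRowsV_eq_affine`, `hasFDerivAt_periodRowsV_apply`, `differentiableAt_periodChartMatrixV`, **`differentiableAt_periodZV`**
  (at every `v ∈ negCone` with `γ J_Φ γ⁻¹ ∈ C0` on the cone), `differentiableOn_periodZV_apply`;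
* §5 THE EXPORT **`periodChartV`** in the `hZ` currency of ★ `hasHolomorphicSiegelLift_of_negConeChart` ∕ E3 `UnitaryCurveSiegelPointMap` (`Ball ↦ negCone`):
  `∀ γ, (∀ v ∈ negCone (H^τ), conjJ γ (J_Φ v) ∈ C0 δ) → ∃ Z, (∀ i j, DifferentiableOn ℂ (Z · i j) (negCone (H^τ))) ∧ ∀ v ∈ negCone (H^τ), Z v ∈ 𝔥_g ∧ conjJ γ (J_Φ v) = jOfSiegel δ (Z v)`.

## References
* [Deligne1971TravauxShimura] P. Deligne, *Travaux de Shimura*, 1.14–1.15 (holomorphy of the embedding of hermitian symmetric domains), 5.4.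
* [Deligne1979ShimuraVarieties] P. Deligne, *Variétés de Shimura* (1979), Prop. 2.3.10 (PDF p. 32 of Milne's translation).
* [Lange2023AbelianVarietiesComplex] H. Lange, *Abelian Varieties over the Complex Numbers* (2023), §7.1.2 (7.2)–(7.3), Lemma 7.1.6.
* [Milne2005ShimuraVarieties] J. S. Milne, *Introduction to Shimura varieties* (2005), Thm. 5.16, §6 pp. 67–70.
-/

set_option autoImplicit false

noncomputable section

open Matrix NumberField Complex
open scoped TensorProduct ComplexConjugate Classical Topology Matrix.Norms.Elementwise

namespace Literature.AlgebraicGeometry.ShimuraVarieties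

namespace UnitaryCurve

namespace AuxV

open Literature.AlgebraicGeometry.ModuliOfAbelianVarieties
open Literature.AlgebraicGeometry.ModuliOfAbelianVarieties.SiegelModuli
open Literature.AlgebraicGeometry.Motives (CMType)
open Literature.NumberTheory.Automorphic (siegelUpperHalfSpace mem_siegelUpperHalfSpace_iff)
open Literature.AlgebraicGeometry.ShimuraVarieties.UnitaryCanonicalModel.Aux (ratBasis iPhi iPhiVal coe_iPhi embOf)

variable {L : Type} [Field L] (M : Type) [Field M] [NumberField M] [IsCMField M] {j : L →+* M}
  {n : ℕ} {H : Matrix (Fin n) (Fin n) L} {ξ : M} {g : ℕ} {δ : Fin g → ℕ}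
  (F : SymplecticFrameV M j H ξ g δ) (Φ : CMType M) (τ : L →+* ℂ) (k : Fin n)

/-! ### §1. `n·#Φ = g` and the reindexing of the census -/

include F in
/-- **`n·#Φ = g`**: the frame `β : M^n ≃ ℚ^{g⊕g}` forces `2g = n·[M:ℚ]`, and `2·#Φ = [M:ℚ]` (★ `two_mul_card_eq_finrank`).
[cite: Deligne1979ShimuraVarieties, Prop. 2.3.10 (PDF p. 32)] -/
theorem card_index_eq : Fintype.card (Φ.1 × Fin n) = g := by
  have h1 : Module.finrank ℚ (Fin n → M) = Module.finrank ℚ (Fin g ⊕ Fin g → ℚ) := LinearEquiv.finrank_eq F.β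
  rw [Module.finrank_pi_fintype, Finset.sum_const, Finset.card_univ, smul_eq_mul, Module.finrank_fintype_fun_eq_card] at h1
  simp only [Fintype.card_sum, Fintype.card_fin] at h1
  have h2 := Literature.NumberTheory.ComplexMultiplication.CMTypeLattice.two_mul_card_eq_finrank Φ
  simp only [Fintype.card_prod, Fintype.card_fin]
  have h3 : 2 * (Fintype.card Φ.1 * n) = g + g := by rw [← h1, ← h2]; ring
  omega

/-- The reindexing of the census rows by `Fin g`. [cite: Deligne1979ShimuraVarieties, Prop. 2.3.10 (PDF p. 32)] -/
def rowEquivV : Φ.1 × Fin n ≃ Fin g :=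
  Fintype.equivFinOfCardEq (card_index_eq M F Φ)

/-! ### §2. The matrices `S_k(v)`, `R_k(v) = S_k(v)·Q_ℂ·γ⁻¹` and the eigen-relation `R·(γJγ⁻¹)_ℂ = i·R` -/

/-- **`S_k(v)`**: the `g` census rows of the chart `k` at the parameter `v ∈ ℂⁿ`, as a `g × n[M:ℚ]` complex matrix. [cite: Deligne1979ShimuraVarieties, Prop. 2.3.10 (PDF p. 32)] -/
def censusMatrixV (v : Fin n → ℂ) : Matrix (Fin g) (Fin n × Fin (Module.finrank ℚ M)) ℂ :=
  Matrix.of fun r => censusRowV M Φ j τ H k ((rowEquivV M F Φ).symm r) v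

/-- The complexified inverse frame matrix `Q_ℂ`. [cite: Deligne1979ShimuraVarieties, Prop. 2.3.10 (PDF p. 32)] -/
def frameQVC : Matrix (Fin n × Fin (Module.finrank ℚ M)) (Fin g ⊕ Fin g) ℂ :=
  (frameQV F).map (algebraMap ℚ ℂ)

/-- The complexified frame matrix `P_ℂ`. [cite: Deligne1979ShimuraVarieties, Prop. 2.3.10 (PDF p. 32)] -/
def framePVC : Matrix (Fin g ⊕ Fin g) (Fin n × Fin (Module.finrank ℚ M)) ℂ :=
  (framePV F).map (algebraMap ℚ ℂ)

/-- `Q_ℂ P_ℂ = 1`. [cite: Deligne1979ShimuraVarieties, Prop. 2.3.10 (PDF p. 32)] -/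
theorem frameQVC_mul_framePVC : frameQVC M F * framePVC M F = 1 := by
  rw [frameQVC, framePVC, ← Matrix.map_mul, frameQV_mul_framePV, Matrix.map_one _ (map_zero _) (map_one _)]

/-- `P_ℂ Q_ℂ = 1`. [cite: Deligne1979ShimuraVarieties, Prop. 2.3.10 (PDF p. 32)] -/
theorem framePVC_mul_frameQVC : framePVC M F * frameQVC M F = 1 := by
  rw [frameQVC, framePVC, ← Matrix.map_mul, framePV_mul_frameQV, Matrix.map_one _ (map_zero _) (map_one _)]

/-- **`R_k(v) = S_k(v)·Q_ℂ·γ_ℂ⁻¹`** for a real similitude `γ`. [cite: Deligne1979ShimuraVarieties, Prop. 2.3.10 (PDF p. 32)] -/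
def periodRowsV (γ : GL (Fin g ⊕ Fin g) ℝ) (v : Fin n → ℂ) : Matrix (Fin g) (Fin g ⊕ Fin g) ℂ :=
  censusMatrixV M F Φ τ k v * frameQVC M F * ((γ⁻¹ : GL (Fin g ⊕ Fin g) ℝ) : Matrix (Fin g ⊕ Fin g) (Fin g ⊕ Fin g) ℝ).map ((↑) : ℝ → ℂ)

/-- `γ_ℂ⁻¹·γ_ℂ = 1`. [cite: Milne2005ShimuraVarieties, §6 p. 68] -/
theorem map_inv_mul_map (γ : GL (Fin g ⊕ Fin g) ℝ) :
    ((γ⁻¹ : GL (Fin g ⊕ Fin g) ℝ) : Matrix (Fin g ⊕ Fin g) (Fin g ⊕ Fin g) ℝ).map ((↑) : ℝ → ℂ) *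
        (γ : Matrix (Fin g ⊕ Fin g) (Fin g ⊕ Fin g) ℝ).map ((↑) : ℝ → ℂ) = 1 := by
  rw [← Complex.coe_algebraMap, ← Matrix.map_mul, ← Units.val_mul, inv_mul_cancel, Units.val_one, Matrix.map_one _ (map_zero _) (map_one _)]

/-- `R_k(v)·(γ_ℂ·P_ℂ) = S_k(v)`. [cite: Deligne1979ShimuraVarieties, Prop. 2.3.10 (PDF p. 32)] -/
theorem periodRowsV_mul (γ : GL (Fin g ⊕ Fin g) ℝ) (v : Fin n → ℂ) :
    periodRowsV M F Φ τ k γ v * ((γ : Matrix (Fin g ⊕ Fin g) (Fin g ⊕ Fin g) ℝ).map ((↑) : ℝ → ℂ) * framePVC M F) =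
      censusMatrixV M F Φ τ k v := by
  rw [periodRowsV, Matrix.mul_assoc, Matrix.mul_assoc,
    ← Matrix.mul_assoc (((γ⁻¹ : GL (Fin g ⊕ Fin g) ℝ) : Matrix (Fin g ⊕ Fin g) (Fin g ⊕ Fin g) ℝ).map _), map_inv_mul_map,
    Matrix.one_mul, frameQVC_mul_framePVC, Matrix.mul_one]

/-- **The complexified `auxRepV`**: `(auxRepV ℝ β p)_ℂ = P_ℂ · res(t·X)_ℂ · Q_ℂ` for `p = (t, X)` (★ `auxRepV` read over `ℂ`).
[cite: Deligne1979ShimuraVarieties, Prop. 2.3.10 (PDF p. 32)] -/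
theorem coe_auxRepV_map_ofReal (p : (ℝ ⊗[ℚ] M)ˣ × GL (Fin n) (ℝ ⊗[ℚ] M)) :
    ((auxRepV ℝ F p : GL (Fin g ⊕ Fin g) ℝ) : Matrix (Fin g ⊕ Fin g) (Fin g ⊕ Fin g) ℝ).map ((↑) : ℝ → ℂ) =
      framePVC M F * (resMatrix (Algebra.TensorProduct.basis ℝ (ratBasis M))
          ((blockGLV (ℝ ⊗[ℚ] M) p : GL (Fin n) (ℝ ⊗[ℚ] M)) : Matrix (Fin n) (Fin n) (ℝ ⊗[ℚ] M))).map (algebraMap ℝ ℂ) * frameQVC M F := by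
  have hmaps : ((algebraMap ℝ ℂ : ℝ → ℂ) ∘ (algebraMap ℚ ℝ : ℚ → ℝ)) = (algebraMap ℚ ℂ : ℚ → ℂ) := by
    funext q
    simp
  rw [auxRepV, MonoidHom.comp_apply, MonoidHom.comp_apply, coe_conjRect, coe_resGL,
    ← Complex.coe_algebraMap, Matrix.map_mul, Matrix.map_mul, framePVR, frameQVR, Matrix.map_map, Matrix.map_map, hmaps,
    framePVC, frameQVC]

/-- **The complexified `J_Φ(v)`**: `J_Φ(v)_ℂ = P_ℂ · res(B_v)_ℂ · Q_ℂ`. [cite: Deligne1979ShimuraVarieties, Prop. 2.3.10 (PDF p. 32)] -/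
theorem auxComplexStructureV_map_ofReal (v : Fin n → ℂ) :
    (auxComplexStructureV F τ Φ v).map ((↑) : ℝ → ℂ) =
      framePVC M F * (resMatrix (Algebra.TensorProduct.basis ℝ (ratBasis M))
          (((blockGLV (ℝ ⊗[ℚ] M) (iPhi M Φ, sPhiV M j Φ τ H v) : GL (Fin n) (ℝ ⊗[ℚ] M)) :
            Matrix (Fin n) (Fin n) (ℝ ⊗[ℚ] M)))).map (algebraMap ℝ ℂ) * frameQVC M F :=
  coe_auxRepV_map_ofReal M F (iPhi M Φ, sPhiV M j Φ τ H v)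

/-- `S_k(v)·res(B_v)_ℂ = i·S_k(v)` (row by row, ★ FILE B `censusRowV_vecMul_resMatrix`; `q(v) ≠ 0`). [cite: Deligne1979ShimuraVarieties, Prop. 2.3.10 (PDF p. 32)] -/
theorem censusMatrixV_mul_resMatrix {v : Fin n → ℂ} (hv : formH (H.map τ) v ≠ 0) :
    censusMatrixV M F Φ τ k v *
        (resMatrix (Algebra.TensorProduct.basis ℝ (ratBasis M))
          (((blockGLV (ℝ ⊗[ℚ] M) (iPhi M Φ, sPhiV M j Φ τ H v) : GL (Fin n) (ℝ ⊗[ℚ] M)) :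
            Matrix (Fin n) (Fin n) (ℝ ⊗[ℚ] M)))).map (algebraMap ℝ ℂ) =
      Complex.I • censusMatrixV M F Φ τ k v := by
  ext r p
  have h := congrFun (censusRowV_vecMul_resMatrix M Φ j τ H k hv ((rowEquivV M F Φ).symm r)) p
  simpa only [censusMatrixV, Matrix.mul_apply, Matrix.vecMul, dotProduct, Matrix.of_apply, Matrix.smul_apply, Pi.smul_apply] using h

/-- **`R_k(v)·(γ J_Φ(v) γ⁻¹)_ℂ = i·R_k(v)`**: the rows of `R_k` are left `+i`-eigenrows of the translated complex structure (`q(v) ≠ 0`).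
[cite: Deligne1979ShimuraVarieties, Prop. 2.3.10 (PDF p. 32)] -/
theorem periodRowsV_mul_conjJ (γ : GL (Fin g ⊕ Fin g) ℝ) {v : Fin n → ℂ} (hv : formH (H.map τ) v ≠ 0) :
    periodRowsV M F Φ τ k γ v * (conjJ γ (auxComplexStructureV F τ Φ v)).map ((↑) : ℝ → ℂ) =
      Complex.I • periodRowsV M F Φ τ k γ v := by
  rw [conjJ_def, ← Complex.coe_algebraMap, Matrix.map_mul, Matrix.map_mul, Complex.coe_algebraMap,
    auxComplexStructureV_map_ofReal M F Φ τ v, periodRowsV]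
  calc censusMatrixV M F Φ τ k v * frameQVC M F * ((γ⁻¹ : GL (Fin g ⊕ Fin g) ℝ) : Matrix (Fin g ⊕ Fin g) (Fin g ⊕ Fin g) ℝ).map ((↑) : ℝ → ℂ) *
        ((γ : Matrix (Fin g ⊕ Fin g) (Fin g ⊕ Fin g) ℝ).map ((↑) : ℝ → ℂ) * (framePVC M F * (resMatrix (Algebra.TensorProduct.basis ℝ (ratBasis M))
          (((blockGLV (ℝ ⊗[ℚ] M) (iPhi M Φ, sPhiV M j Φ τ H v) : GL (Fin n) (ℝ ⊗[ℚ] M)) :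
            Matrix (Fin n) (Fin n) (ℝ ⊗[ℚ] M)))).map (algebraMap ℝ ℂ) * frameQVC M F) *
          ((γ⁻¹ : GL (Fin g ⊕ Fin g) ℝ) : Matrix (Fin g ⊕ Fin g) (Fin g ⊕ Fin g) ℝ).map ((↑) : ℝ → ℂ))
      = censusMatrixV M F Φ τ k v * (frameQVC M F * ((((γ⁻¹ : GL (Fin g ⊕ Fin g) ℝ) : Matrix (Fin g ⊕ Fin g) (Fin g ⊕ Fin g) ℝ).map ((↑) : ℝ → ℂ) *
          (γ : Matrix (Fin g ⊕ Fin g) (Fin g ⊕ Fin g) ℝ).map ((↑) : ℝ → ℂ)) * framePVC M F)) *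
          (resMatrix (Algebra.TensorProduct.basis ℝ (ratBasis M))
            (((blockGLV (ℝ ⊗[ℚ] M) (iPhi M Φ, sPhiV M j Φ τ H v) : GL (Fin n) (ℝ ⊗[ℚ] M)) :
              Matrix (Fin n) (Fin n) (ℝ ⊗[ℚ] M)))).map (algebraMap ℝ ℂ) *
          frameQVC M F * ((γ⁻¹ : GL (Fin g ⊕ Fin g) ℝ) : Matrix (Fin g ⊕ Fin g) (Fin g ⊕ Fin g) ℝ).map ((↑) : ℝ → ℂ) := by
        simp only [Matrix.mul_assoc]
    _ = Complex.I • (censusMatrixV M F Φ τ k v * frameQVC M F * ((γ⁻¹ : GL (Fin g ⊕ Fin g) ℝ) : Matrix (Fin g ⊕ Fin g) (Fin g ⊕ Fin g) ℝ).map ((↑) : ℝ → ℂ)) := by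
        rw [map_inv_mul_map, Matrix.one_mul, frameQVC_mul_framePVC, Matrix.mul_one, censusMatrixV_mul_resMatrix M F Φ τ k hv, Matrix.smul_mul,
          Matrix.smul_mul]

/-- **The rows of `R_k(v)` are linearly independent on the chart** (`v_k ≠ 0`, `q(v) ≠ 0`): `S_k(v) = R_k(v)·(γ_ℂ P_ℂ)` has independent rows
(★ FILE B `linearIndependent_censusRowV`). [cite: Deligne1979ShimuraVarieties, Prop. 2.3.10 (PDF p. 32)] -/
theorem periodRowsV_vecMul_injective (γ : GL (Fin g ⊕ Fin g) ℝ) {v : Fin n → ℂ} (hk : v k ≠ 0) (hv : formH (H.map τ) v ≠ 0) :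
    Function.Injective (periodRowsV M F Φ τ k γ v).vecMul := by
  have hS : Function.Injective (censusMatrixV M F Φ τ k v).vecMul := by
    rw [Matrix.vecMul_injective_iff]
    exact (linearIndependent_censusRowV M Φ j τ H k hk hv).comp (rowEquivV M F Φ).symm (rowEquivV M F Φ).symm.injective
  intro x y hxy
  apply hS
  have := congrArg (fun w => w ᵥ* ((γ : Matrix (Fin g ⊕ Fin g) (Fin g ⊕ Fin g) ℝ).map ((↑) : ℝ → ℂ) * framePVC M F)) hxy
  simpa only [Matrix.vecMul_vecMul, periodRowsV_mul] using this

/-! ### §3. The period matrix `Z(v) = siegelOfJ δ (γ J_Φ(v) γ⁻¹)`, intrinsically, and its chart formula -/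

/-- **THE PERIOD MATRIX `Z(v)` of the translated complex structure `γ J_Φ(v) γ⁻¹`** (★ `siegelOfJ`: the normalized period matrix of Lange's Lemma 7.1.6;
chart-free and intrinsic — on each chart it EQUALS `Δ·R_k(v)₂⁻¹·R_k(v)₁`, `periodZV_eq_chart`). [cite: Lange2023AbelianVarietiesComplex, §7.1.2 (7.2)–(7.3)]
[cite: Deligne1979ShimuraVarieties, Prop. 2.3.10 (PDF p. 32)] -/
def periodZV (γ : GL (Fin g ⊕ Fin g) ℝ) (v : Fin n → ℂ) : Matrix (Fin g) (Fin g) ℂ :=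
  siegelOfJ δ (conjJ γ (auxComplexStructureV F τ Φ v))

variable {M F Φ τ}

/-- **`Z(v) ∈ 𝔥_g`** whenever `γ J_Φ(v) γ⁻¹ ∈ C0 δ` (★ `siegelOfJ_mem`). [cite: Lange2023AbelianVarietiesComplex, §7.1.2 Lemma 7.1.6 (1)] -/
theorem periodZV_mem {γ : GL (Fin g ⊕ Fin g) ℝ} {v : Fin n → ℂ} (hC0 : conjJ γ (auxComplexStructureV F τ Φ v) ∈ C0 δ) :
    periodZV M F Φ τ γ v ∈ siegelUpperHalfSpace g :=
  siegelOfJ_mem hC0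

/-- **`γ J_Φ(v) γ⁻¹ = J(Z(v))`** whenever `γ J_Φ(v) γ⁻¹ ∈ C0 δ` (★ `jOfSiegel_siegelOfJ`). [cite: Lange2023AbelianVarietiesComplex, §7.1.2 (7.2)–(7.3)] -/
theorem conjJ_eq_jOfSiegel_periodZV (hδ : ∀ i, 0 < δ i) {γ : GL (Fin g ⊕ Fin g) ℝ} {v : Fin n → ℂ}
    (hC0 : conjJ γ (auxComplexStructureV F τ Φ v) ∈ C0 δ) :
    conjJ γ (auxComplexStructureV F τ Φ v) = jOfSiegel δ (periodZV M F Φ τ γ v) :=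
  (jOfSiegel_siegelOfJ hC0 hδ).symm

/-- **`Z(c • v) = Z(v)`** (`c ≠ 0`): the period matrix depends on the negative line only (★ FILE A2 `auxComplexStructureV_smul`).
[cite: Deligne1979ShimuraVarieties, Prop. 2.3.10 (PDF p. 32)] -/
theorem periodZV_smul (γ : GL (Fin g ⊕ Fin g) ℝ) {c : ℂ} (hc : c ≠ 0) (v : Fin n → ℂ) :
    periodZV M F Φ τ γ (c • v) = periodZV M F Φ τ γ v := by
  rw [periodZV, periodZV, auxComplexStructureV_smul F τ Φ v hc]

variable (M F Φ τ)

/-- The chart expression `Δ·R_k(v)₂⁻¹·R_k(v)₁` (a rational function of `v ∈ ℂⁿ`). [cite: Lange2023AbelianVarietiesComplex, §7.1.2 (7.3)] -/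
def periodChartMatrixV (γ : GL (Fin g ⊕ Fin g) ℝ) (v : Fin n → ℂ) : Matrix (Fin g) (Fin g) ℂ :=
  (Matrix.diagonal fun i => (δ i : ℂ)) * (periodRowsV M F Φ τ k γ v).toCols₂⁻¹ * (periodRowsV M F Φ τ k γ v).toCols₁

/-- **`Z(v) = Δ·R_k(v)₂⁻¹·R_k(v)₁` on the chart `v_k ≠ 0`** when `γ J_Φ(v) γ⁻¹ ∈ C0 δ` (★ `siegelOfJ_eq_of_leftEigenrows`; `q(v) ≠ 0`).
[cite: Lange2023AbelianVarietiesComplex, §7.1.2 (7.3) and Lemma 7.1.6 (1)] -/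
theorem periodZV_eq_chart (hδ : ∀ i, 0 < δ i) (γ : GL (Fin g ⊕ Fin g) ℝ) {v : Fin n → ℂ} (hk : v k ≠ 0) (hv : formH (H.map τ) v ≠ 0)
    (hC0 : conjJ γ (auxComplexStructureV F τ Φ v) ∈ C0 δ) :
    periodZV M F Φ τ γ v = periodChartMatrixV M F Φ τ k γ v := by
  rw [periodZV, periodChartMatrixV, siegelOfJ_eq_of_leftEigenrows hδ hC0 (periodRowsV M F Φ τ k γ v) (periodRowsV_mul_conjJ M F Φ τ k γ hv)
    (periodRowsV_vecMul_injective M F Φ τ k γ hk hv)]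

/-- `R_k(v)₂` is invertible on the chart when `γ J_Φ(v) γ⁻¹ ∈ C0 δ`. [cite: Lange2023AbelianVarietiesComplex, §7.1.2 (7.3)] -/
theorem det_periodRowsV_toCols₂_ne_zero (hδ : ∀ i, 0 < δ i) (γ : GL (Fin g ⊕ Fin g) ℝ) {v : Fin n → ℂ} (hk : v k ≠ 0)
    (hv : formH (H.map τ) v ≠ 0) (hC0 : conjJ γ (auxComplexStructureV F τ Φ v) ∈ C0 δ) :
    ((periodRowsV M F Φ τ k γ v).toCols₂).det ≠ 0 := by
  have h := isUnit_toCols₂_of_vecMul_injective hδ hC0 _ (periodRowsV_mul_conjJ M F Φ τ k γ hv) (periodRowsV_vecMul_injective M F Φ τ k γ hk hv)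
  rw [Matrix.isUnit_iff_isUnit_det] at h
  exact h.ne_zero

/-! ### §4. Holomorphy: `R_k(v)` is affine in `v`, so `Δ·R₂⁻¹·R₁` is holomorphic where `det R₂ ≠ 0` -/

section MatrixCalculus

variable {E : Type} [NormedAddCommGroup E] [NormedSpace ℂ E] {m m' : Type} [Fintype m] [Fintype m']

omit [Fintype m] in
/-- A matrix-valued map is differentiable iff its entries are. [folklore] -/
private theorem differentiableAt_matrix {A : E → Matrix m m' ℂ} {x : E}
    (h : ∀ i l, DifferentiableAt ℂ (fun y => A y i l) x) : DifferentiableAt ℂ A x :=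
  differentiableAt_pi.2 fun i => differentiableAt_pi.2 fun l => h i l

omit [Fintype m] in
/-- Entries of a differentiable matrix-valued map are differentiable. [folklore] -/
private theorem differentiableAt_matrix_entry {A : E → Matrix m m' ℂ} {x : E}
    (h : DifferentiableAt ℂ A x) (i : m) (l : m') : DifferentiableAt ℂ (fun y => A y i l) x :=
  differentiableAt_pi.1 (differentiableAt_pi.1 h i) l

omit [Fintype m] in
/-- Products of differentiable matrix-valued maps are differentiable. [folklore] -/
private theorem differentiableAt_matrix_mul {p : Type} [Fintype p] {A : E → Matrix m m' ℂ} {B : E → Matrix m' p ℂ} {x : E}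
    (hA : DifferentiableAt ℂ A x) (hB : DifferentiableAt ℂ B x) :
    DifferentiableAt ℂ (fun y => A y * B y) x :=
  differentiableAt_matrix fun i l => by
    simp only [Matrix.mul_apply]
    exact DifferentiableAt.fun_sum fun l' _ => (differentiableAt_matrix_entry hA i l').mul (differentiableAt_matrix_entry hB l' l)

/-- The determinant of a differentiable matrix-valued map is differentiable (Leibniz formula). [folklore] -/
private theorem differentiableAt_matrix_det [DecidableEq m'] {A : E → Matrix m' m' ℂ} {x : E}
    (hA : DifferentiableAt ℂ A x) : DifferentiableAt ℂ (fun y => (A y).det) x := by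
  simp only [Matrix.det_apply']
  refine DifferentiableAt.fun_sum fun σ _ => DifferentiableAt.const_mul ?_ _
  exact (HasFDerivAt.finsetProd fun i _ => (differentiableAt_matrix_entry hA (σ i) i).hasFDerivAt).differentiableAt

/-- The adjugate of a differentiable matrix-valued map is differentiable. [folklore] -/
private theorem differentiableAt_matrix_adjugate [DecidableEq m'] {A : E → Matrix m' m' ℂ} {x : E}
    (hA : DifferentiableAt ℂ A x) : DifferentiableAt ℂ (fun y => (A y).adjugate) x :=
  differentiableAt_matrix fun i l => by
    simp only [Matrix.adjugate_apply]
    refine differentiableAt_matrix_det (differentiableAt_matrix fun l' l'' => ?_)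
    simp only [Matrix.updateRow_apply]
    split_ifs
    · exact differentiableAt_const _
    · exact differentiableAt_matrix_entry hA l' l''

/-- The inverse of a differentiable matrix-valued map is differentiable where `det ≠ 0`. [folklore] -/
private theorem differentiableAt_matrix_inv [DecidableEq m'] {A : E → Matrix m' m' ℂ} {x : E}
    (hA : DifferentiableAt ℂ A x) (hdet : (A x).det ≠ 0) :
    DifferentiableAt ℂ (fun y => (A y)⁻¹) x := by
  have h : (fun y => (A y)⁻¹) = fun y => ((A y).det)⁻¹ • (A y).adjugate := by
    funext y
    rw [Matrix.inv_def, Ring.inverse_eq_inv']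
  rw [h]
  exact ((differentiableAt_matrix_det hA).inv hdet).smul (differentiableAt_matrix_adjugate hA)

end MatrixCalculus

/-- The slope matrices `S_{k,a}` (`a : Fin n`) of the affine map `v ↦ S_k(v)`. [cite: Deligne1979ShimuraVarieties, Prop. 2.3.10 (PDF p. 32)] -/
def censusSlopeMatrixV (a : Fin n) : Matrix (Fin g) (Fin n × Fin (Module.finrank ℚ M)) ℂ :=
  Matrix.of fun r => eigRowV M (censusEmbV M Φ j τ k ((rowEquivV M F Φ).symm r).1 ((rowEquivV M F Φ).symm r).2)
    (censusSlopeV M Φ j τ H k a ((rowEquivV M F Φ).symm r).1 ((rowEquivV M F Φ).symm r).2)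

/-- **`S_k(v) = S_k(0) + Σ_a v_a·S_{k,a}`.** [cite: Deligne1979ShimuraVarieties, Prop. 2.3.10 (PDF p. 32)] -/
theorem censusMatrixV_eq_affine (v : Fin n → ℂ) :
    censusMatrixV M F Φ τ k v = censusMatrixV M F Φ τ k 0 + ∑ a, v a • censusSlopeMatrixV M F Φ τ k a := by
  ext r q
  have h := congrFun (censusRowV_eq_affine M Φ j τ H k ((rowEquivV M F Φ).symm r) v) q
  simpa only [censusMatrixV, censusSlopeMatrixV, Matrix.of_apply, Matrix.add_apply, Matrix.sum_apply, Matrix.smul_apply, Pi.add_apply,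
    Finset.sum_apply, Pi.smul_apply] using h

/-- The slope matrices `R_{k,a} = S_{k,a}·Q_ℂ·γ⁻¹` of `v ↦ R_k(v)`. [cite: Deligne1979ShimuraVarieties, Prop. 2.3.10 (PDF p. 32)] -/
def periodRowsSlopeV (γ : GL (Fin g ⊕ Fin g) ℝ) (a : Fin n) : Matrix (Fin g) (Fin g ⊕ Fin g) ℂ :=
  censusSlopeMatrixV M F Φ τ k a * frameQVC M F * ((γ⁻¹ : GL (Fin g ⊕ Fin g) ℝ) : Matrix (Fin g ⊕ Fin g) (Fin g ⊕ Fin g) ℝ).map ((↑) : ℝ → ℂ)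

/-- **`R_k(v) = R_k(0) + Σ_a v_a·R_{k,a}`.** [cite: Deligne1979ShimuraVarieties, Prop. 2.3.10 (PDF p. 32)] -/
theorem periodRowsV_eq_affine (γ : GL (Fin g ⊕ Fin g) ℝ) (v : Fin n → ℂ) :
    periodRowsV M F Φ τ k γ v = periodRowsV M F Φ τ k γ 0 + ∑ a, v a • periodRowsSlopeV M F Φ τ k γ a := by
  rw [periodRowsV, periodRowsV, censusMatrixV_eq_affine M F Φ τ k v, Matrix.add_mul, Matrix.add_mul, Matrix.sum_mul, Matrix.sum_mul]
  congr 1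
  refine Finset.sum_congr rfl fun a _ => ?_
  rw [periodRowsSlopeV, Matrix.smul_mul, Matrix.smul_mul]

/-- **The entries of `R_k(v)` are affine, with derivative `w ↦ Σ_a w_a·(R_{k,a})_{ic}`.** [cite: Deligne1971TravauxShimura, 1.14] -/
theorem hasFDerivAt_periodRowsV_apply (γ : GL (Fin g ⊕ Fin g) ℝ) (v₀ : Fin n → ℂ) (i : Fin g) (c : Fin g ⊕ Fin g) :
    HasFDerivAt (fun v : Fin n → ℂ => periodRowsV M F Φ τ k γ v i c)
      (∑ a, (ContinuousLinearMap.proj (R := ℂ) (φ := fun _ : Fin n => ℂ) a).smulRight (periodRowsSlopeV M F Φ τ k γ a i c)) v₀ := by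
  have h : (fun v : Fin n → ℂ => periodRowsV M F Φ τ k γ v i c) = fun v =>
      periodRowsV M F Φ τ k γ 0 i c + ∑ a, (ContinuousLinearMap.proj (R := ℂ) (φ := fun _ : Fin n => ℂ) a) v • periodRowsSlopeV M F Φ τ k γ a i c := by
    funext v
    rw [periodRowsV_eq_affine M F Φ τ k γ v]
    simp only [Matrix.add_apply, Matrix.sum_apply, Matrix.smul_apply, smul_eq_mul, ContinuousLinearMap.proj_apply]
  rw [h]
  refine HasFDerivAt.const_add _ ?_
  exact HasFDerivAt.fun_sum fun a _ => ((ContinuousLinearMap.proj (R := ℂ) (φ := fun _ : Fin n => ℂ) a).hasFDerivAt).smul_const _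

/-- `v ↦ R_k(v)` is differentiable (entries affine). [cite: Deligne1971TravauxShimura, 1.14] -/
theorem differentiableAt_periodRowsV (γ : GL (Fin g ⊕ Fin g) ℝ) (v₀ : Fin n → ℂ) :
    DifferentiableAt ℂ (fun v : Fin n → ℂ => periodRowsV M F Φ τ k γ v) v₀ :=
  differentiableAt_matrix fun i c => (hasFDerivAt_periodRowsV_apply M F Φ τ k γ v₀ i c).differentiableAt

/-- **`v ↦ Δ·R_k(v)₂⁻¹·R_k(v)₁` is differentiable where `det R_k(v)₂ ≠ 0`.** [cite: Deligne1971TravauxShimura, 1.14] -/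
theorem differentiableAt_periodChartMatrixV (γ : GL (Fin g ⊕ Fin g) ℝ) (v₀ : Fin n → ℂ)
    (hdet : ((periodRowsV M F Φ τ k γ v₀).toCols₂).det ≠ 0) :
    DifferentiableAt ℂ (fun v : Fin n → ℂ => periodChartMatrixV M F Φ τ k γ v) v₀ := by
  have hR := differentiableAt_periodRowsV M F Φ τ k γ v₀
  have h2 : DifferentiableAt ℂ (fun v : Fin n → ℂ => (periodRowsV M F Φ τ k γ v).toCols₂) v₀ :=
    differentiableAt_matrix fun i l => differentiableAt_matrix_entry hR i (Sum.inr l)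
  have h1 : DifferentiableAt ℂ (fun v : Fin n → ℂ => (periodRowsV M F Φ τ k γ v).toCols₁) v₀ :=
    differentiableAt_matrix fun i l => differentiableAt_matrix_entry hR i (Sum.inl l)
  unfold periodChartMatrixV
  exact differentiableAt_matrix_mul (differentiableAt_matrix_mul (differentiableAt_const _) (differentiableAt_matrix_inv h2 hdet)) h1

variable {k}

/-- **`v ↦ Z(v)` is differentiable at every point of the negative cone** when `γ J_Φ γ⁻¹ ∈ C0 δ` along the cone: near `v₀` (`v₀ ≠ 0`, pick `k` with
`(v₀)_k ≠ 0`) `Z` agrees with the chart expression on the open set `negCone ∩ {v_k ≠ 0}`. [cite: Deligne1971TravauxShimura, 1.14–1.15] -/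
theorem differentiableAt_periodZV (hδ : ∀ i, 0 < δ i) (γ : GL (Fin g ⊕ Fin g) ℝ)
    (hC0 : ∀ v ∈ negCone (H.map τ), conjJ γ (auxComplexStructureV F τ Φ v) ∈ C0 δ) {v₀ : Fin n → ℂ} (hv₀ : v₀ ∈ negCone (H.map τ)) :
    DifferentiableAt ℂ (fun v : Fin n → ℂ => periodZV M F Φ τ γ v) v₀ := by
  obtain ⟨k, hk⟩ := Function.ne_iff.1 (ne_zero_of_mem_negCone (H.map τ) hv₀)
  have hU : IsOpen (negCone (H.map τ) ∩ {v : Fin n → ℂ | v k ≠ 0}) :=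
    (isOpen_negCone (H.map τ)).inter (isOpen_ne_fun (continuous_apply k) continuous_const)
  have hmem : v₀ ∈ negCone (H.map τ) ∩ {v : Fin n → ℂ | v k ≠ 0} := ⟨hv₀, hk⟩
  have heq : (fun v : Fin n → ℂ => periodZV M F Φ τ γ v) =ᶠ[𝓝 v₀] fun v => periodChartMatrixV M F Φ τ k γ v :=
    Filter.eventuallyEq_of_mem (hU.mem_nhds hmem) fun v hv =>
      periodZV_eq_chart M F Φ τ k hδ γ hv.2 (formH_ne_zero_of_mem_negCone (H.map τ) hv.1) (hC0 v hv.1)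
  refine heq.differentiableAt_iff.2 ?_
  exact differentiableAt_periodChartMatrixV M F Φ τ k γ v₀
    (det_periodRowsV_toCols₂_ne_zero M F Φ τ k hδ γ hk (formH_ne_zero_of_mem_negCone (H.map τ) hv₀) (hC0 v₀ hv₀))

/-- **The entries of `Z` are holomorphic on the negative cone.** [cite: Deligne1971TravauxShimura, 1.14–1.15] -/
theorem differentiableOn_periodZV_apply (hδ : ∀ i, 0 < δ i) (γ : GL (Fin g ⊕ Fin g) ℝ)
    (hC0 : ∀ v ∈ negCone (H.map τ), conjJ γ (auxComplexStructureV F τ Φ v) ∈ C0 δ) (i l : Fin g) :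
    DifferentiableOn ℂ (fun v : Fin n → ℂ => periodZV M F Φ τ γ v i l) (negCone (H.map τ)) := fun _ hv =>
  (differentiableAt_matrix_entry (differentiableAt_periodZV M F Φ τ hδ γ hC0 hv) i l).differentiableWithinAt

/-! ### §5. The export: the period chart of `J_Φ` in the negative-cone currency of ★ `hasHolomorphicSiegelLift_of_negConeChart` ∕ E3 -/

/-- **THE PERIOD CHART OF `J_Φ` (E2 EXPORT (F1)).**  For every real `γ` with `γ J_Φ(v) γ⁻¹ ∈ S⁺_δ = C0 δ` along the negative cone of `H^τ` there is
`Z : ℂⁿ → M_g(ℂ)` — namely `Z = periodZV F τ Φ γ` — entrywise holomorphic on the cone, `𝔥_g`-valued there, with `γ J_Φ(v) γ⁻¹ = J(Z(v))`.  This is the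
hypothesis `hZ` of E3 `UnitaryCurveSiegelPointMap` ∕ ★ `hasHolomorphicSiegelLift_of_negConeChart` with `Ball ↦ negCone`, and the source of the E-line fields
`AuxChartGS.Z_hol ∕ Z_mem` (with `Z a := periodZV F τ Φ γ_a` for the slice translate `γ_a`).  [cite: Deligne1971TravauxShimura, 1.14–1.15 and 5.4]
[cite: Deligne1979ShimuraVarieties, Prop. 2.3.10 (PDF p. 32)] [cite: Milne2005ShimuraVarieties, Thm. 5.16 and §6 pp. 67–70] -/
theorem periodChartV (hδ : ∀ i, 0 < δ i) (γ : GL (Fin g ⊕ Fin g) ℝ)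
    (hC0 : ∀ v ∈ negCone (H.map τ), conjJ γ (auxComplexStructureV F τ Φ v) ∈ C0 δ) :
    ∃ Z : (Fin n → ℂ) → Matrix (Fin g) (Fin g) ℂ,
      (∀ i l : Fin g, DifferentiableOn ℂ (fun v => Z v i l) (negCone (H.map τ))) ∧
        ∀ v ∈ negCone (H.map τ), Z v ∈ siegelUpperHalfSpace g ∧ conjJ γ (auxComplexStructureV F τ Φ v) = jOfSiegel δ (Z v) :=
  ⟨periodZV M F Φ τ γ, differentiableOn_periodZV_apply M F Φ τ hδ γ hC0,
    fun v hv => ⟨periodZV_mem (hC0 v hv), conjJ_eq_jOfSiegel_periodZV hδ (hC0 v hv)⟩⟩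

end AuxV

end UnitaryCurve

end Literature.AlgebraicGeometry.ShimuraVarieties

end
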